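import Mathlib
import Summits.Ventures.PercRepro2.TypedPocketOA2CertA

/-!
# The `{o, a₂}`-pocket class (HARRIS-2), II′: the Harris certificates, B (blind cell PercRepro2,
p3 g8, 2026-08-26; `proofs/P3-HARRIS.md` §6)

Slices 6–11 of the remainder check of `TypedPocketOA2CertA.lean`, and the assembly:
**`remQ_nonneg`** — on every valid pair of triples the doubly symmetrised kernel dominates the
certified combination of slacks (`dsymQ ≥ combQ`), by sorting both sides (`dsymQ_sort3O/B`,
`combQ` is symmetric in the o-states and depends on the far triple only through its sorted
representative) and the 20 decided slices.  Own work; standard axioms.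
-/

namespace Summit.Ventures.PercRepro2

namespace CovForm

namespace PocketOA2

open OneTyped SepThree

/-! ## The slices 6–11 -/
/-- Slice 6: three sorted o-triples. -/
theorem allOkAtQ_6 :
    (allOkAtQ (false, false, true) (false, false, true) (true, true, true) &&
      allOkAtQ (false, false, true) (false, true, false) (false, true, false) &&
      allOkAtQ (false, false, true) (false, true, false) (true, false, false)) = true := by
  decide +kernel

/-- Slice 7: three sorted o-triples. -/
theorem allOkAtQ_7 :
    (allOkAtQ (false, false, true) (false, true, false) (true, true, true) &&
      allOkAtQ (false, false, true) (true, false, false) (true, false, false) &&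
      allOkAtQ (false, false, true) (true, false, false) (true, true, true)) = true := by
  decide +kernel

/-- Slice 8: three sorted o-triples. -/
theorem allOkAtQ_8 :
    (allOkAtQ (false, false, true) (true, true, true) (true, true, true) &&
      allOkAtQ (false, true, false) (false, true, false) (false, true, false) &&
      allOkAtQ (false, true, false) (false, true, false) (true, false, false)) = true := by
  decide +kernel

/-- Slice 9: three sorted o-triples. -/
theorem allOkAtQ_9 :
    (allOkAtQ (false, true, false) (false, true, false) (true, true, true) &&
      allOkAtQ (false, true, false) (true, false, false) (true, false, false) &&
      allOkAtQ (false, true, false) (true, false, false) (true, true, true)) = true := by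
  decide +kernel

/-- Slice 10: three sorted o-triples. -/
theorem allOkAtQ_10 :
    (allOkAtQ (false, true, false) (true, true, true) (true, true, true) &&
      allOkAtQ (true, false, false) (true, false, false) (true, false, false) &&
      allOkAtQ (true, false, false) (true, false, false) (true, true, true)) = true := by
  decide +kernel

/-- Slice 11: two sorted o-triples. -/
theorem allOkAtQ_11 :
    (allOkAtQ (true, false, false) (true, true, true) (true, true, true) &&
      allOkAtQ (true, true, true) (true, true, true) (true, true, true)) = true := by
  decide +kernel

/-! ## The assembly -/

/-- The nonnegativity on the sorted representatives as a Boolean computation (12 slices). -/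
theorem remQ_nonneg_all : (oTriples.all fun s => allOkAtQ s.1 s.2.1 s.2.2) = true := by
  rw [oTriples_eq]
  simp only [List.all_cons, List.all_nil, Bool.and_true, Bool.and_eq_true]
  have h0 := and3 allOkAtQ_0
  have h1 := and3 allOkAtQ_1
  have h2 := and3 allOkAtQ_2
  have h3 := and3 allOkAtQ_3
  have h4 := and3 allOkAtQ_4
  have h5 := and3 allOkAtQ_5
  have h6 := and3 allOkAtQ_6
  have h7 := and3 allOkAtQ_7
  have h8 := and3 allOkAtQ_8
  have h9 := and3 allOkAtQ_9
  have h10 := and3 allOkAtQ_10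
  have h11 := (Bool.and_eq_true _ _).mp allOkAtQ_11
  exact ⟨h0.1, h0.2.1, h0.2.2, h1.1, h1.2.1, h1.2.2, h2.1, h2.2.1, h2.2.2,
    h3.1, h3.2.1, h3.2.2, h4.1, h4.2.1, h4.2.2, h5.1, h5.2.1, h5.2.2,
    h6.1, h6.2.1, h6.2.2, h7.1, h7.2.1, h7.2.2, h8.1, h8.2.1, h8.2.2,
    h9.1, h9.2.1, h9.2.2, h10.1, h10.2.1, h10.2.2, h11.1, h11.2⟩

/-- **The remainder is nonnegative on every sorted pair of valid triples.** -/
theorem remQ_nonneg_sorted : ∀ s ∈ oTriples, ∀ t ∈ bTriples,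
    0 ≤ remQ s.1 s.2.1 s.2.2 t.1 t.2.1 t.2.2 := by
  rintro ⟨x, y, w⟩ hs ⟨u, v, r⟩ ht
  rw [mem_oTriples] at hs
  rw [mem_bTriples] at ht
  have key := remQ_nonneg_all
  simp only [List.all_eq_true] at key
  have h := key (x, y, w) (mem_oTriples.2 hs)
  simp only [allOkAtQ, bSorted, List.all_eq_true, decide_eq_true_eq, List.mem_filter] at h
  exact h u ht.1.1 v ⟨ht.1.2.1, ht.2.1⟩ r ⟨ht.1.2.2, ht.2.2⟩

/-- `combQ` is symmetric in the first two o-states. -/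
lemma combQ_swapO12 (x y w : OSt) (u v r : BSt) : combQ x y w u v r = combQ y x w u v r := by
  unfold combQ
  congr 1
  refine List.map_congr_left fun c _ => ?_
  unfold genQ
  ring

/-- `combQ` is symmetric in the last two o-states. -/
lemma combQ_swapO23 (x y w : OSt) (u v r : BSt) : combQ x y w u v r = combQ x w y u v r := by
  unfold combQ
  congr 1
  refine List.map_congr_left fun c _ => ?_
  unfold genQ
  ring

/-- `combQ` is unchanged by sorting the o-states. -/
lemma combQ_sort3O (x y w : OSt) (u v r : BSt) :
    combQ x y w u v r = combQ (sort3O x y w).1 (sort3O x y w).2.1 (sort3O x y w).2.2 u v r := by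
  unfold sort3O
  split_ifs <;> dsimp only <;>
    first
    | rfl
    | exact combQ_swapO12 x y w u v r
    | exact combQ_swapO23 x y w u v r
    | exact (combQ_swapO12 x y w u v r).trans (combQ_swapO23 y x w u v r)
    | exact (combQ_swapO23 x y w u v r).trans (combQ_swapO12 x w y u v r)
    | exact ((combQ_swapO12 x y w u v r).trans (combQ_swapO23 y x w u v r)).trans
        (combQ_swapO12 y w x u v r)

/-- **THE KERNEL DOMINATES THE CERTIFIED COMBINATION on valid o-states and SORTED far states.** -/
theorem dsymQ_ge_combQ_sorted (x y w : OSt) (u v r : BSt) (hx : ValidO x = true)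
    (hy : ValidO y = true) (hw : ValidO w = true) (ht : (u, v, r) ∈ bTriples) :
    combQ x y w u v r ≤ dsymQ x y w u v r := by
  rw [dsymQ_sort3O, combQ_sort3O]
  have h := remQ_nonneg_sorted _ (sort3O_mem x y w hx hy hw) _ ht
  unfold remQ at h
  exact sub_nonneg.1 h

end PocketOA2

end CovForm

end Summit.Ventures.PercRepro2
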